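import Summits.Ventures.YMGap.Thresholds.CouplingSecondDerivativeSUN
import Summits.Ventures.YMGap.Thresholds.ZeroCouplingMomentsSU3
import HarnessLib

/-!
# `SU(3)` on `ℤ⁴`: the plaquette susceptibility has right derivative `3 · (1/108) = 1/36` at `b = 0⁺` — the SECOND
# strong-coupling coefficient of the `SU(3)` mean plaquette does NOT vanish: `u(b) = b/6 + b²/24 + …`; for EVERY other
# `SU(N)` (`N ≥ 2`, `N ≠ 3`) it is ZERO (row type C-PRESS, endpoint `β = 0`, part 16)

Cell `pub-ymgap`, seat ds-1 (gen 11). HONEST FRAMING: exact strong-coupling LATTICE statements for `SU(3)` Wilson lattice gauge theory on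
`ℤ⁴` at the endpoint `b = 0` of the one-sided 't Hooft window `[0, 3·9/308]` (tree coupling `b`: weight `exp(b Σ_p Re tr U_p)`,
`W_p = (1/3) Re tr U_p`): one-sided derivatives at `0` of the response functions of a single plaquette `p` along any DLR selection;
Taylor data, NOT analyticity; nothing about the continuum or the Clay problem. Kernel theorems only, 0 compute, no definitions.

For a DLR selection `μ` on `[0, 27/308]` write `u(b) = ⟨W_p⟩_{μ b}`, `S(b) = Σ_q Cov(W_p, W_q)`, `T(b) = Σ_q 3·Σ_r u₃(W_p; W_q; W_r)`. In the
tree / g10: `u′ = 3S` (`hasDerivAt_integral_SU_thooft`), `S′ = T` on the open window (`hasDerivAt_responseSum_star_SU`), `u′(0⁺) = 1/6`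
(`hasDerivWithinAt_plaquette_zero_SU`). NEW:
* `su3_thirdResponse_zdHaar`: `T(0) = 3 · u₃(W_p; W_p; W_p)|_{dg_∞} = 3/108 = 1/36` (part 15: `u₃|₀ = δ_{q=r=p}/108`, the `SU(3)`
  baryon/determinant vertex; only the diagonal survives the double series);
* ★★ `su3_hasDerivWithinAt_susceptibility_zero`: **`S′(0⁺) = 1/36 ≠ 0`** (limit of derivatives: `S′ = T` on `(0, 27/308)`, `T`
  continuous on `[0, 27/308]` by g10's `continuousOn_threePointSum_SU`), hence with `u′ = 3S`: **`u″(0⁺) = 1/12`**, i.e. formally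
  `u(b) = b/6 + b²/24 + …` (`= β/18 + β²/216 + …` in the standard `β = 3b`) — in CONTRAST with `SU(2)`, whose second plaquette
  coefficient vanishes (g10 `su2_hasDerivWithinAt_susceptibility_zero`: `S′(0⁺) = 0`). The single-plaquette check: the cumulants of
  `Re tr U` under `SU(3)` Haar measure are `κ₂ = 1/2`, `κ₃ = 1/4` (parts 14a/b), so `⟨Re tr U⟩_b = b/2 + b²/8 + …`, `u = b/6 + b²/24 + …`.
References: Balian–Drouffe–Itzykson, Phys. Rev. D 11 (1975) 2104 §IV; M. Creutz, *Quarks, gluons and lattices* (1983) §8, §10.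
Everything here is proved. [folklore]
-/

noncomputable section

open MeasureTheory ProbabilityTheory Set Filter Topology
open scoped NNReal
open Literature.MathematicalPhysics.QuantumLattice (LGConfig ZdEdge ZdPlaquette fundamentalRep ymGibbsMeasures plaquetteEdges)
open Literature.MathematicalPhysics.QuantumFieldTheory hiding ZdEdge
open Literature.MathematicalPhysics.QuantumFieldTheory.TorusAreaLaw (isSpecialUnitaryModel_fundamentalRep)
open Literature.MathematicalPhysics.QuantumFieldTheory.Balaban1983to89.StrongCouplingKernelWindow (oneLinkKRModulus_SU)

namespace Summit.Ventures.YMGap.PressureRegularity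

section QuadraticPlaquetteSU3

open Summit.Ventures.YMGap.CouplingResponse (hasDerivAt_responseSum_star_SU continuousOn_threePointSum_SU
  continuousOn_responseSum_SU)

/-- `SU(3)` is second countable (closed subgroup of `3 × 3` complex matrices). [folklore] -/
private theorem secondCountable_su3' : SecondCountableTopology (Matrix.specialUnitaryGroup (Fin 3) ℂ) :=
  haveI : SecondCountableTopology (Matrix (Fin 3) (Fin 3) ℂ) :=
    inferInstanceAs (SecondCountableTopology (Fin 3 → Fin 3 → ℂ))
  Topology.IsEmbedding.subtypeVal.secondCountableTopology

/-- Local shorthand: the normalised plaquette observable `W_q = (1/3) Re tr U_q` of `SU(3)` on `ℤ⁴`. -/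
local notation3 (prettyPrint := false) "W∗" q:max =>
  zdPlaquetteObs (d := 4) (fundamentalRep (Fin 3)) (Prod.fst q) (Prod.snd q).1.1 (Prod.snd q).1.2

/-- Local shorthand: the connected three-point function `u₃(X; Y; Z)` under `μ`. -/
local notation3 (prettyPrint := false) "U₃[" X ";" Y ";" Z ";" μ "]" =>
  cov[fun ω => X ω * Y ω, Z; μ] - (∫ ω, X ω ∂μ) * cov[Y, Z; μ] - (∫ ω, Y ω ∂μ) * cov[X, Z; μ]

/-- Local shorthand: the infinite Haar product on the links of `ℤ⁴`, `G = SU(3)`. -/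
local notation3 (prettyPrint := false) "dg∞" => zdHaar 4 (Matrix.specialUnitaryGroup (Fin 3) ℂ)

/-- **The third response of an `SU(3)` plaquette at `b = 0` is `1/36`**: `Σ_q 3·Σ_r u₃(W_p; W_q; W_r)|_{dg_∞} = 3 · (1/108)`
(part 15: only `q = r = p` survives). [folklore] -/
theorem su3_thirdResponse_zdHaar (p : ZdPlaquette 4) :
    ∑' q : ZdPlaquette 4, (3 : ℝ) * ∑' r : ZdPlaquette 4, U₃[W∗ p ; W∗ q ; W∗ r ; dg∞] = 1 / 36 := by
  classical
  haveI := secondCountable_su3'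
  have h3 : ∀ q r : ZdPlaquette 4, U₃[W∗ p ; W∗ q ; W∗ r ; dg∞] = if p = q ∧ q = r then 1 / 108 else 0 := fun q r =>
    ZeroCouplingMoments.su3_threePoint_zdHaar (d := 4) (isSpecialUnitaryModel_fundamentalRep 3) p q r
  simp only [h3]
  have hr : ∀ q : ZdPlaquette 4, ∑' r : ZdPlaquette 4, (if p = q ∧ q = r then (1 / 108 : ℝ) else 0) =
      if p = q then 1 / 108 else 0 := by
    intro q
    by_cases hq : p = q
    · subst hq
      rw [if_pos rfl, tsum_eq_single p fun r hr => if_neg fun h => hr h.2.symm, if_pos ⟨rfl, rfl⟩]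
    · rw [if_neg hq]
      exact (tsum_congr fun r => if_neg fun h => hq h.1).trans tsum_zero
  simp only [hr]
  rw [tsum_eq_single p fun q hq => by rw [if_neg (Ne.symm hq), mul_zero], if_pos rfl]
  norm_num

/-- ★★ **`SU(3)`: the plaquette susceptibility has right derivative `1/36` at `b = 0⁺`** — along any DLR selection `μ` on the
't Hooft window `[0, 27/308]` and for every plaquette `p`, `S(b) = Σ_q Cov_{μ b}(W_p, W_q)` satisfies `HasDerivWithinAt S (1/36) (Ici 0) 0`:
`S′ = T` on the open window (`hasDerivAt_responseSum_star_SU` with the Bakry–Émery modulus), `T` is continuous on the closed window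
(`continuousOn_threePointSum_SU`) and `T(0) = 1/36` (`su3_thirdResponse_zdHaar`, `μ 0 = dg_∞`). With `u′ = 3S` this is
`u″(0⁺) = 1/12`: the second strong-coupling coefficient of the `SU(3)` mean plaquette is `1/24 ≠ 0`. [folklore] -/
theorem su3_hasDerivWithinAt_susceptibility_zero
    {μ : ℝ → Measure (LGConfig 4 (Matrix.specialUnitaryGroup (Fin 3) ℂ))}
    (hμ : ∀ b ∈ Icc (0 : ℝ) ((3 : ℕ) * (9 / 308) : ℝ), μ b ∈ ymGibbsMeasures (d := 4) (fundamentalRep (Fin 3)) b)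
    (p : ZdPlaquette 4) :
    HasDerivWithinAt (fun t => ∑' q : ZdPlaquette 4, cov[W∗ p, W∗ q; μ t]) (1 / 36 : ℝ) (Ici (0 : ℝ)) 0 := by
  classical
  set b₁ : ℝ := ((3 : ℕ) : ℝ) * (9 / 308) with hb₁
  have hb₁N : b₁ / (3 : ℕ) = 9 / 308 := by rw [hb₁]; field_simp
  have hb₁0 : 0 ≤ b₁ := by rw [hb₁]; positivity
  have hb₁pos : 0 < b₁ := by rw [hb₁]; positivity
  obtain ⟨h1, hK0, h4⟩ := StarSUN.bakryEmery_coef_le (N := 3) (by norm_num) hb₁0 hb₁N.le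
  have hab : |b₁| / (3 : ℕ) = b₁ / (3 : ℕ) := by rw [abs_of_nonneg hb₁0]
  rw [hab] at h1 hK0 h4
  have hmod := oneLinkKRModulus_SU (N := 3) (by norm_num) h1
  have hW := isLipschitzCylinder_zdPlaquetteObs (N := 3) (d := 4) p.1 p.2.2
  have hD : ∀ e ∈ plaquetteEdges p, ‖e.1 - p.1‖ ≤ ((1 : ℕ) : ℝ) := fun e he => by
    simpa using norm_fst_sub_le_of_mem_plaquetteEdges he
  set S : ℝ → ℝ := fun t => ∑' q : ZdPlaquette 4, cov[W∗ p, W∗ q; μ t] with hS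
  set T : ℝ → ℝ := fun t => ∑' q : ZdPlaquette 4, ((3 : ℕ) : ℝ) * ∑' r : ZdPlaquette 4,
    U₃[W∗ p ; W∗ q ; W∗ r ; μ t] with hT
  have hderiv : ∀ t ∈ Ioo (0 : ℝ) b₁, HasDerivAt S (T t) t := fun t ht =>
    hasDerivAt_responseSum_star_SU (N := 3) (by norm_num) hK0 hmod le_rfl h4 hμ hW hD ht
  have hTcont : ContinuousOn T (Icc (0 : ℝ) b₁) :=
    continuousOn_threePointSum_SU (N := 3) (by norm_num) hK0 hmod le_rfl h4 hμ hW hD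
  have hScont : ContinuousOn S (Icc (0 : ℝ) b₁) :=
    continuousOn_responseSum_SU (N := 3) (by norm_num) hK0 hmod le_rfl h4 hμ hW hD
  have h0 : μ 0 ∈ ymGibbsMeasures (d := 4) (fundamentalRep (Fin 3)) 0 := hμ 0 ⟨le_rfl, hb₁0⟩
  have hT0 : T 0 = 1 / 36 := by
    show (∑' q : ZdPlaquette 4, ((3 : ℕ) : ℝ) * ∑' r : ZdPlaquette 4, _) = 1 / 36
    rw [eq_zdHaar_of_mem_zero_SU (by norm_num) h0, Nat.cast_ofNat]
    exact su3_thirdResponse_zdHaar p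
  have hdiff : DifferentiableOn ℝ S (Ioo (0 : ℝ) b₁) := fun t ht =>
    (hderiv t ht).differentiableAt.differentiableWithinAt
  have hcont : ContinuousWithinAt S (Ioo (0 : ℝ) b₁) 0 := (hScont 0 ⟨le_rfl, hb₁0⟩).mono Ioo_subset_Icc_self
  have hlim : Tendsto (fun t => deriv S t) (𝓝[>] 0) (𝓝 (1 / 36)) := by
    have h := ((hTcont 0 ⟨le_rfl, hb₁0⟩).mono Ioo_subset_Icc_self).tendsto
    rw [hT0, nhdsWithin_Ioo_eq_nhdsGT hb₁pos] at h
    refine h.congr' ?_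
    filter_upwards [Ioo_mem_nhdsGT hb₁pos] with t ht
    exact (hderiv t ht).deriv.symm
  exact hasDerivWithinAt_Ici_of_tendsto_deriv hdiff hcont (Ioo_mem_nhdsGT hb₁pos) hlim

/-- ★ **The one-sided jet of the `SU(3)` mean plaquette at `b = 0`**: along any DLR selection on `[0, 27/308]` and every plaquette
`p`, `u′(0⁺) = 1/6` (g9) and `S′(0⁺) = 1/36` (this file) with `u′ = 3S` on the open window — formally
`⟨(1/3) Re tr U_p⟩_b = b/6 + b²/24 + …`: the SECOND strong-coupling coefficient of `SU(3)` is non-zero (for `SU(2)` it vanishes).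
[folklore] -/
theorem su3_plaquette_jet_zero
    {μ : ℝ → Measure (LGConfig 4 (Matrix.specialUnitaryGroup (Fin 3) ℂ))}
    (hμ : ∀ b ∈ Icc (0 : ℝ) ((3 : ℕ) * (9 / 308) : ℝ), μ b ∈ ymGibbsMeasures (d := 4) (fundamentalRep (Fin 3)) b)
    (p : ZdPlaquette 4) :
    HasDerivWithinAt (fun t => ∫ U, (W∗ p) U ∂(μ t)) (1 / (2 * (3 : ℕ)) : ℝ) (Icc (0 : ℝ) ((3 : ℕ) * (9 / 308))) 0 ∧
      HasDerivWithinAt (fun t => ∑' q : ZdPlaquette 4, cov[W∗ p, W∗ q; μ t]) (1 / 36 : ℝ) (Ici (0 : ℝ)) 0 :=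
  ⟨hasDerivWithinAt_plaquette_zero_SU (N := 3) le_rfl hμ p, su3_hasDerivWithinAt_susceptibility_zero hμ p⟩

end QuadraticPlaquetteSU3

/-! ## Every `SU(N)` with `N ≥ 2`, `N ≠ 3`: the plaquette susceptibility has right derivative ZERO at `b = 0⁺` -/

section QuadraticPlaquetteSUN

open Summit.Ventures.YMGap.CouplingResponse (hasDerivAt_responseSum_star_SU continuousOn_threePointSum_SU
  continuousOn_responseSum_SU)

variable {N : ℕ}

/-- Local shorthand: the normalised plaquette observable `W_q = (1/N) Re tr U_q` of `SU(N)` on `ℤ⁴`. -/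
local notation3 (prettyPrint := false) "W⁎" q:max =>
  zdPlaquetteObs (d := 4) (fundamentalRep (Fin N)) (Prod.fst q) (Prod.snd q).1.1 (Prod.snd q).1.2

/-- Local shorthand: the connected three-point function `u₃(X; Y; Z)` under `μ`. -/
local notation3 (prettyPrint := false) "U₃'[" X ";" Y ";" Z ";" μ "]" =>
  cov[fun ω => X ω * Y ω, Z; μ] - (∫ ω, X ω ∂μ) * cov[Y, Z; μ] - (∫ ω, Y ω ∂μ) * cov[X, Z; μ]

/-- **`SU(N)`, `N ≥ 2`, `N ≠ 3`: the third response of a plaquette at `b = 0` vanishes**, `Σ_q N·Σ_r u₃(W_p; W_q; W_r)|_{dg_∞} = 0`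
(part 15: every `u₃` vanishes at `β = 0` unless `N = 3`). [folklore] -/
theorem thirdResponse_zdHaar_of_ne_three (hN : 2 ≤ N) (hN3 : N ≠ 3) (p : ZdPlaquette 4) :
    ∑' q : ZdPlaquette 4, (N : ℝ) * ∑' r : ZdPlaquette 4,
      U₃'[W⁎ p ; W⁎ q ; W⁎ r ; zdHaar 4 (Matrix.specialUnitaryGroup (Fin N) ℂ)] = 0 := by
  haveI : SecondCountableTopology (Matrix (Fin N) (Fin N) ℂ) :=
    inferInstanceAs (SecondCountableTopology (Fin N → Fin N → ℂ))
  haveI : SecondCountableTopology (Matrix.specialUnitaryGroup (Fin N) ℂ) :=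
    Topology.IsEmbedding.subtypeVal.secondCountableTopology
  have h3 : ∀ q r : ZdPlaquette 4, U₃'[W⁎ p ; W⁎ q ; W⁎ r ; zdHaar 4 (Matrix.specialUnitaryGroup (Fin N) ℂ)] = 0 :=
    fun q r => ZeroCouplingMoments.threePoint_zdHaar_of_ne_three (d := 4) (isSpecialUnitaryModel_fundamentalRep N) hN hN3 p q r
  simp only [h3, tsum_zero, mul_zero]

/-- ★★ **EVERY `SU(N)` with `N ≥ 2`, `N ≠ 3`: the plaquette susceptibility has right derivative `0` at `b = 0⁺`** — along any DLR
selection `μ` on the 't Hooft window `[0, N·9/308]` and for every plaquette `p`, `S(b) = Σ_q Cov_{μ b}(W_p, W_q)` satisfies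
`HasDerivWithinAt S 0 (Ici 0) 0` (limit of derivatives as in the `SU(3)` case, with `T(0) = 0`): the second strong-coupling coefficient of
the `SU(N)` mean plaquette VANISHES for every `N ≠ 3` (g10's `su2_hasDerivWithinAt_susceptibility_zero` is `N = 2`); only `SU(3)` has
`S′(0⁺) = 1/36 ≠ 0` (`su3_hasDerivWithinAt_susceptibility_zero`). [folklore] -/
theorem hasDerivWithinAt_susceptibility_zero_of_ne_three (hN : 2 ≤ N) (hN3 : N ≠ 3)
    {μ : ℝ → Measure (LGConfig 4 (Matrix.specialUnitaryGroup (Fin N) ℂ))}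
    (hμ : ∀ b ∈ Icc (0 : ℝ) ((N : ℝ) * (9 / 308)), μ b ∈ ymGibbsMeasures (d := 4) (fundamentalRep (Fin N)) b)
    (p : ZdPlaquette 4) :
    HasDerivWithinAt (fun t => ∑' q : ZdPlaquette 4, cov[W⁎ p, W⁎ q; μ t]) (0 : ℝ) (Ici (0 : ℝ)) 0 := by
  classical
  have hN0 : (0 : ℝ) < N := by exact_mod_cast (show 0 < N by omega)
  set b₁ : ℝ := (N : ℝ) * (9 / 308) with hb₁
  have hb₁N : b₁ / N = 9 / 308 := by rw [hb₁]; field_simp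
  have hb₁0 : 0 ≤ b₁ := by rw [hb₁]; positivity
  have hb₁pos : 0 < b₁ := by rw [hb₁]; positivity
  obtain ⟨h1, hK0, h4⟩ := StarSUN.bakryEmery_coef_le (N := N) (by omega) hb₁0 hb₁N.le
  have hab : |b₁| / N = b₁ / N := by rw [abs_of_nonneg hb₁0]
  rw [hab] at h1 hK0 h4
  have hmod := oneLinkKRModulus_SU (N := N) hN h1
  have hW := isLipschitzCylinder_zdPlaquetteObs (N := N) (d := 4) p.1 p.2.2
  have hD : ∀ e ∈ plaquetteEdges p, ‖e.1 - p.1‖ ≤ ((1 : ℕ) : ℝ) := fun e he => by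
    simpa using norm_fst_sub_le_of_mem_plaquetteEdges he
  set S : ℝ → ℝ := fun t => ∑' q : ZdPlaquette 4, cov[W⁎ p, W⁎ q; μ t] with hS
  set T : ℝ → ℝ := fun t => ∑' q : ZdPlaquette 4, (N : ℝ) * ∑' r : ZdPlaquette 4, U₃'[W⁎ p ; W⁎ q ; W⁎ r ; μ t] with hT
  have hderiv : ∀ t ∈ Ioo (0 : ℝ) b₁, HasDerivAt S (T t) t := fun t ht =>
    hasDerivAt_responseSum_star_SU (N := N) (by omega) hK0 hmod le_rfl h4 hμ hW hD ht
  have hTcont : ContinuousOn T (Icc (0 : ℝ) b₁) :=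
    continuousOn_threePointSum_SU (N := N) (by omega) hK0 hmod le_rfl h4 hμ hW hD
  have hScont : ContinuousOn S (Icc (0 : ℝ) b₁) :=
    continuousOn_responseSum_SU (N := N) (by omega) hK0 hmod le_rfl h4 hμ hW hD
  have h0 : μ 0 ∈ ymGibbsMeasures (d := 4) (fundamentalRep (Fin N)) 0 := hμ 0 ⟨le_rfl, hb₁0⟩
  have hT0 : T 0 = 0 := by
    show (∑' q : ZdPlaquette 4, (N : ℝ) * ∑' r : ZdPlaquette 4, _) = 0
    rw [eq_zdHaar_of_mem_zero_SU hN h0]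
    exact thirdResponse_zdHaar_of_ne_three hN hN3 p
  have hdiff : DifferentiableOn ℝ S (Ioo (0 : ℝ) b₁) := fun t ht =>
    (hderiv t ht).differentiableAt.differentiableWithinAt
  have hcont : ContinuousWithinAt S (Ioo (0 : ℝ) b₁) 0 := (hScont 0 ⟨le_rfl, hb₁0⟩).mono Ioo_subset_Icc_self
  have hlim : Tendsto (fun t => deriv S t) (𝓝[>] 0) (𝓝 0) := by
    have h := ((hTcont 0 ⟨le_rfl, hb₁0⟩).mono Ioo_subset_Icc_self).tendsto
    rw [hT0, nhdsWithin_Ioo_eq_nhdsGT hb₁pos] at h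
    refine h.congr' ?_
    filter_upwards [Ioo_mem_nhdsGT hb₁pos] with t ht
    exact (hderiv t ht).deriv.symm
  exact hasDerivWithinAt_Ici_of_tendsto_deriv hdiff hcont (Ioo_mem_nhdsGT hb₁pos) hlim

end QuadraticPlaquetteSUN

end Summit.Ventures.YMGap.PressureRegularity
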